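import Summits.KontsevichZagierPeriods.KontsevichZagierPeriods.Theorems.OctahedralSymmetryOctahedralSpanAllWeightsStubRegularUnitManyTwosTools
import Summits.KontsevichZagierPeriods.KontsevichZagierPeriods.Theorems.OctahedralSymmetryOctahedralSpanAllWeightsConjStable
import Summits.KontsevichZagierPeriods.KontsevichZagierPeriods.Theorems.OctahedralSymmetryOctahedralSpanAllWeightsRealForm
import Summits.KontsevichZagierPeriods.KontsevichZagierPeriods.Theorems.OctahedralSymmetryOctahedralSpanAllWeightsStubRegularUnitFront
import Summits.KontsevichZagierPeriods.KontsevichZagierPeriods.Theorems.OctahedralSymmetryOctahedralSpanAllWeightsStubRegularE0DepthOne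
import Mathlib.LinearAlgebra.Span.Basic
import HarnessLib

/-!
# Crux `OctahedralSpanAllWeights` (stmt-KontsevichZagierPeriods-9659), line `Sketch`:
# the σ-inclusion–exclusion — unit words with a majority of letters `2` reduce, in every weight

Helper file for block F2 of the line `Sketch` (unit words, letters `1, 2, 3` = poles `i, −1, −i`;
the block lowers the number of letters `2`).  **Theorem `unit_manyTwos` (all weights).**  A unit word
`W` of length `n` with MORE letters `2` than other letters (`n < 2 · #2(W)`) lies, modulo the relation
module `rel`, in the span of the unit words of length `n` with fewer letters `2`.  Only involution
generators are used, and only those of words with MORE non-`2` letters than `W` (which are "lower").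

## The mechanism (new; found in the line's exact-rank lab, then proved)

For a unit word `U` with non-`2` letters at the position set `S`, Zhao's involution table
(`σ(1) = [3] − [2]`, `σ(3) = [1] − [2]`, `σ(2) = −[2]`) expands multilinearly:
`sigmaSubst U = Σ_{T ⊆ S} (−1)^{|T|} [reverse of (Ū on T, 2 elsewhere)]`, so that modulo `rel` the word
`U` equals an alternating sum over the SUBSETS of its non-`2` positions.  If `W` has `j` non-`2` letters
and at least `j + 1` letters `2`, mark `j + 1` of its `2`-positions (set `R`), and sum the involution
generators of the `2^j` words `U_{R ∪ P}` (`P ⊆` non-`2` positions of `W`, letter `1` on `R`) with signs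
`(−1)^{|P|}`: by inclusion–exclusion every subset term cancels except the one supported exactly on the
non-`2` positions of `W` — which is `W` itself (up to the bijection reverse ∘ conjugate) — and terms with
MORE than `j` non-`2` letters.  All the words `U_{R ∪ P}` have `≥ j + 1` non-`2` letters.  Hence
`[W] ∈ rel + (lower)`.  In the file this is organised WITHOUT position sets: the alternating sum is the
multilinear expansion `expand lam T` of a TEMPLATE word `T` (the word with the chosen `2`-positions
marked by the letter `0`) under a letter table `lam`, the sum of the involution images is the expansion
under the COMPOSITE table (`expandZ_ofTerms_expand`, multilinearity), and the composite table
`psi` (`0 ↦ [3] − [2]`, `1 ↦ −[3]`, `2 ↦ −[2]`, `3 ↦ −[1]`) visibly expands to `±[W̄] + lower`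
(`main_term`).  Exact-rank check of the statement (lab of the line, `exp9.py`): the layer with `j`
non-`2` letters is killed by these generators alone for all `n ≥ 2j + 1` tested (`n ≤ 8`), and NOT for
`n = 2j` — the hypothesis `n < 2 · #2(W)` is sharp for this mechanism.

## Contents

* (file 1/2 `…ManyTwosTools`: `expandZ`, multilinearity `expandZ_ofTerms_expand`, templates `mark`/`unmark`.)
* §3 the tables `lam`, `psi`, the main-term computation `main_term`, the lower-ness of the words of
  `expand lam T` (`lam_terms_lower`), the sum of the involution images (`sum_sigmaSubst`).
* §4 `unit_manyTwos` (registered helper stub of the crux; namespace `OctaSpan`).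

Sources: J. Zhao, *Multiple polylogarithm values at roots of unity*, C. R. Acad. Sci. Paris 346 (2008),
§4 (the involution `σ` and its letter table) [Zhao2008]; J. Zhao, Doc. Math. 15 (2010), §2 [Zhao2010].
The inclusion–exclusion itself is new bookkeeping of this line (no published source claims it).
-/

noncomputable section

namespace Summit.KontsevichZagierPeriods.OctahedralSymmetry.OctaSpan.ManyTwos

open Literature.NumberTheory.Transcendental Literature.NumberTheory.Transcendental.LevelFour

/-! ## 3. The tables, the main term, the lower terms -/

/-- The TEMPLATE table `lam`: markers `0` get the letter `1`; a unit letter `c` expands to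
`[2] − [c]` (the sign `(−1)^{|P|}` of the inclusion–exclusion); letters `2` stay. [folklore] -/
def lam : Fin 5 → List (ℤ × Fin 5) := ![[(1, 1)], [(1, 2), (-1, 1)], [(1, 2)], [(1, 2), (-1, 3)], []]

/-- The COMPOSITE table `chi = lam` followed by Zhao's `sigmaLetter`. [cite: Zhao2008, §4] -/
def chi : Fin 5 → List (ℤ × Fin 5) := compT lam sigmaLetter

/-- `chi 0 = [3] − [2]`. [cite: Zhao2008, §4] -/
theorem chi_zero : chi 0 = [(1, 3), (-1, 2)] := by decide
/-- `chi 1 = −[2] − [3] + [2]`. [cite: Zhao2008, §4] -/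
theorem chi_one : chi 1 = [(-1, 2), (-1, 3), (1, 2)] := by decide
/-- `chi 2 = −[2]`. [cite: Zhao2008, §4] -/
theorem chi_two : chi 2 = [(-1, 2)] := by decide
/-- `chi 3 = −[2] − [1] + [2]`. [cite: Zhao2008, §4] -/
theorem chi_three : chi 3 = [(-1, 2), (-1, 1), (1, 2)] := by decide

/-- The `ℚ`-valued expansion of a word under a table. [folklore] -/
def EQ (φ : Fin 5 → List (ℤ × Fin 5)) (T : List (Fin 5)) : WordQ := toQ (ofTerms (expand φ T))

/-- Prepending a letter, linearly on `WordQ`. [folklore] -/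
def consQ (b : Fin 5) : WordQ →ₗ[ℚ] WordQ := Finsupp.lmapDomain ℚ ℚ (List.cons b)

/-- `consQ b [V] = [b :: V]`. [folklore] -/
@[simp] theorem consQ_sym (b : Fin 5) (V : List (Fin 5)) : consQ b (sym V) = sym (b :: V) := by
  simp [consQ, sym, Finsupp.lmapDomain_apply, Finsupp.mapDomain_single]

/-- The recursion of `EQ`: `EQ φ (a :: T) = Σ_{(c,b) ∈ φ a} c • consQ b (EQ φ T)`. [folklore] -/
theorem EQ_cons (φ : Fin 5 → List (ℤ × Fin 5)) (a : Fin 5) (T : List (Fin 5)) :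
    EQ φ (a :: T) = ((φ a).map fun cb => cb.1 • consQ cb.2 (EQ φ T)).sum := by
  rw [EQ, ofTerms_expand_cons, map_list_sum, List.map_map]
  congr 1
  refine List.map_congr_left fun cb _ => ?_
  simp only [Function.comp_apply, map_zsmul, toQ_mapDomain, EQ, consQ]

/-- `EQ φ [] = [[]]`. [folklore] -/
theorem EQ_nil (φ : Fin 5 → List (ℤ × Fin 5)) : EQ φ [] = sym [] := by
  simp [EQ, ofTerms, sym]

/-- **The lower span** `LowQ n c`: unit words of length `n` with fewer than `c` letters `2`. [folklore] -/
abbrev LowQ (n c : ℕ) : Submodule ℚ WordQ :=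
  Submodule.span ℚ (sym '' {V | V.length = n ∧ (∀ a ∈ V, a = 1 ∨ a = 2 ∨ a = 3) ∧ V.count 2 < c})

/-- A qualifying word lies in `LowQ n c`. [folklore] -/
theorem sym_mem_LowQ {n c : ℕ} {V : List (Fin 5)} (h1 : V.length = n)
    (h2 : ∀ a ∈ V, a = 1 ∨ a = 2 ∨ a = 3) (h3 : V.count 2 < c) : sym V ∈ LowQ n c :=
  Submodule.subset_span ⟨V, ⟨h1, h2, h3⟩, rfl⟩

/-- Prepending a unit letter maps `LowQ n c` into `LowQ (n+1) c'` as soon as `c ≤ c'`, and `c < c'`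
if the letter is `2`. [folklore] -/
theorem consQ_mem_LowQ {n c c' : ℕ} {b : Fin 5} (hb : b = 1 ∨ b = 2 ∨ b = 3) (hc : c ≤ c')
    (hb2 : b = 2 → c < c') {x : WordQ} (hx : x ∈ LowQ n c) : consQ b x ∈ LowQ (n + 1) c' := by
  have h := Submodule.mem_map_of_mem (f := consQ b) hx
  rw [Submodule.map_span] at h
  refine Submodule.span_mono ?_ h
  rintro _ ⟨_, ⟨V, ⟨h1, h2, h3⟩, rfl⟩, rfl⟩
  refine ⟨b :: V, ⟨by simp [h1], fun a ha => ?_, ?_⟩, (consQ_sym b V).symm⟩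
  · rcases List.mem_cons.1 ha with rfl | ha
    · exact hb
    · exact h2 a ha
  · by_cases h2b : b = 2
    · subst h2b; rw [List.count_cons_self]; have := hb2 rfl; omega
    · rw [List.count_cons_of_ne h2b]; omega

/-- Reversal maps `LowQ n c` into itself. [folklore] -/
theorem reverse_mem_LowQ {n c : ℕ} {x : WordQ} (hx : x ∈ LowQ n c) :
    Finsupp.lmapDomain ℚ ℚ List.reverse x ∈ LowQ n c := by
  have h := Submodule.mem_map_of_mem (f := Finsupp.lmapDomain ℚ ℚ List.reverse) hx
  rw [Submodule.map_span] at h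
  refine Submodule.span_mono ?_ h
  rintro _ ⟨_, ⟨V, ⟨h1, h2, h3⟩, rfl⟩, rfl⟩
  refine ⟨V.reverse, ⟨by simp [h1], fun a ha => h2 a (List.mem_reverse.1 ha), by simpa using h3⟩, ?_⟩
  simp [sym, Finsupp.lmapDomain_apply, Finsupp.mapDomain_single]

/-- Conjugation of unit letters stays in `{1, 2, 3}` and fixes exactly `2`. [folklore] -/
theorem conjLetter_unit {a : Fin 5} (h : a = 1 ∨ a = 2 ∨ a = 3) :
    (conjLetter a = 1 ∨ conjLetter a = 2 ∨ conjLetter a = 3) ∧ (conjLetter a = 2 ↔ a = 2) := by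
  rcases h with rfl | rfl | rfl <;> decide

/-- The conjugate of a unit word is a unit word with the same number of letters `2`. [folklore] -/
theorem conjWord_unit {W : List (Fin 5)} (h : ∀ a ∈ W, a = 1 ∨ a = 2 ∨ a = 3) :
    (∀ a ∈ conjWord W, a = 1 ∨ a = 2 ∨ a = 3) ∧ (conjWord W).count 2 = W.count 2 := by
  induction W with
  | nil => simp
  | cons b W ih =>
    have hb := h b (by simp)
    have ih' := ih fun a ha => h a (List.mem_cons_of_mem b ha)
    refine ⟨fun a ha => ?_, ?_⟩
    · rw [conjWord_cons] at ha
      rcases List.mem_cons.1 ha with rfl | ha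
      · exact (conjLetter_unit hb).1
      · exact ih'.1 a ha
    · rw [conjWord_cons, List.count_cons, List.count_cons, ih'.2]
      by_cases h2 : b = 2
      · subst h2; simp [conjLetter]
      · have : conjLetter b ≠ 2 := fun h' => h2 ((conjLetter_unit hb).2.1 h')
        simp [h2, this]

/-- The letters of `unmark T` are unit letters when `T` is a template. [folklore] -/
theorem unmark_unit {T : List (Fin 5)} (hT : ∀ a ∈ T, a = 0 ∨ a = 1 ∨ a = 2 ∨ a = 3) :
    ∀ a ∈ unmark T, a = 1 ∨ a = 2 ∨ a = 3 := by
  intro a ha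
  obtain ⟨b, hb, rfl⟩ := List.mem_map.1 ha
  rcases hT b hb with rfl | rfl | rfl | rfl <;> decide

/-- **The main term.** For a template `T` (letters `0, 1, 2, 3`), the expansion under the composite
table `chi` is `(−1)^{|T|} [conj (unmark T)]` plus unit words with FEWER letters `2` than `unmark T`:
at a marker the main choice is `−[2]` and the other choice `[3]` adds a non-`2` letter; at `1`, `3`, `2`
the table is `−[3]`, `−[1]`, `−[2]` after cancellation. [folklore] -/
theorem main_term : ∀ T : List (Fin 5), (∀ a ∈ T, a = 0 ∨ a = 1 ∨ a = 2 ∨ a = 3) →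
    EQ chi T - ((-1 : ℤ) ^ T.length) • sym (conjWord (unmark T)) ∈
      LowQ T.length ((unmark T).count 2)
  | [], _ => by simp [EQ_nil]
  | a :: T, hT => by
    have hT' : ∀ b ∈ T, b = 0 ∨ b = 1 ∨ b = 2 ∨ b = 3 := fun b hb => hT b (List.mem_cons_of_mem a hb)
    have ih := main_term T hT'
    have hU := unmark_unit hT'
    have hCU := (conjWord_unit hU).1
    have hC2 := (conjWord_unit hU).2
    set l := EQ chi T - ((-1 : ℤ) ^ T.length) • sym (conjWord (unmark T)) with hl
    have hE : EQ chi T = l + ((-1 : ℤ) ^ T.length) • sym (conjWord (unmark T)) := by rw [hl]; abel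
    rcases hT a (by simp) with rfl | rfl | rfl | rfl
    · -- marker
      have hrem : consQ 3 l - consQ 2 l + ((-1 : ℤ) ^ T.length) • sym (3 :: conjWord (unmark T)) ∈
          LowQ (T.length + 1) ((unmark T).count 2 + 1) := by
        refine Submodule.add_mem _ (Submodule.sub_mem _ ?_ ?_) (zsmul_mem (sym_mem_LowQ ?_ ?_ ?_) _)
        · exact consQ_mem_LowQ (Or.inr (Or.inr rfl)) (Nat.le_succ _) (fun h => absurd h (by decide)) ih
        · exact consQ_mem_LowQ (Or.inr (Or.inl rfl)) (Nat.le_succ _) (fun _ => Nat.lt_succ_self _) ih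
        · simp
        · intro b hb
          rcases List.mem_cons.1 hb with rfl | hb
          · exact Or.inr (Or.inr rfl)
          · exact hCU b hb
        · rw [List.count_cons_of_ne (by decide), hC2]; exact Nat.lt_succ_self _
      have e1 : (unmark (0 :: T)).count 2 = (unmark T).count 2 + 1 := by simp
      have e2 : (0 :: T).length = T.length + 1 := rfl
      rw [e1, e2]
      convert hrem using 1
      rw [EQ_cons, chi_zero, hE, unmark_cons, if_pos rfl, conjWord_cons]
      have h2 : conjLetter 2 = 2 := rfl
      simp only [List.map_cons, List.map_nil, List.sum_cons, List.sum_nil, add_zero, one_smul,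
        map_add, map_zsmul, consQ_sym, pow_succ, h2, mul_neg, mul_one, neg_smul]
      abel
    · -- letter 1
      have hrem : -consQ 3 l ∈ LowQ (T.length + 1) ((unmark T).count 2) :=
        Submodule.neg_mem _ (consQ_mem_LowQ (Or.inr (Or.inr rfl)) le_rfl (fun h => absurd h (by decide)) ih)
      have e1 : (unmark (1 :: T)).count 2 = (unmark T).count 2 := by simp
      have e2 : (1 :: T).length = T.length + 1 := rfl
      rw [e1, e2]
      convert hrem using 1
      rw [EQ_cons, chi_one, hE, unmark_cons, if_neg (by decide), conjWord_cons]
      have h1 : conjLetter 1 = 3 := rfl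
      simp only [List.map_cons, List.map_nil, List.sum_cons, List.sum_nil, add_zero, one_smul,
        map_add, map_zsmul, consQ_sym, pow_succ, h1, mul_neg, mul_one, neg_smul]
      abel
    · -- letter 2
      have hrem : -consQ 2 l ∈ LowQ (T.length + 1) ((unmark T).count 2 + 1) :=
        Submodule.neg_mem _ (consQ_mem_LowQ (Or.inr (Or.inl rfl)) (Nat.le_succ _) (fun _ => Nat.lt_succ_self _) ih)
      have e1 : (unmark (2 :: T)).count 2 = (unmark T).count 2 + 1 := by simp
      have e2 : (2 :: T).length = T.length + 1 := rfl
      rw [e1, e2]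
      convert hrem using 1
      rw [EQ_cons, chi_two, hE, unmark_cons, if_neg (by decide), conjWord_cons]
      have h1 : conjLetter 2 = 2 := rfl
      simp only [List.map_cons, List.map_nil, List.sum_cons, List.sum_nil, add_zero, one_smul,
        map_add, map_zsmul, consQ_sym, pow_succ, h1, mul_neg, mul_one, neg_smul]
      abel
    · -- letter 3
      have hrem : -consQ 1 l ∈ LowQ (T.length + 1) ((unmark T).count 2) :=
        Submodule.neg_mem _ (consQ_mem_LowQ (Or.inl rfl) le_rfl (fun h => absurd h (by decide)) ih)
      have e1 : (unmark (3 :: T)).count 2 = (unmark T).count 2 := by simp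
      have e2 : (3 :: T).length = T.length + 1 := rfl
      rw [e1, e2]
      convert hrem using 1
      rw [EQ_cons, chi_three, hE, unmark_cons, if_neg (by decide), conjWord_cons]
      have h1 : conjLetter 3 = 1 := rfl
      simp only [List.map_cons, List.map_nil, List.sum_cons, List.sum_nil, add_zero, one_smul,
        map_add, map_zsmul, consQ_sym, pow_succ, h1, mul_neg, mul_one, neg_smul]
      abel


/-- **The words of the template expansion are lower.** Every term of `expand lam T` (template `T`) is a
unit word of the same length, and its number of letters `2` plus the number of markers of `T` is at most
the length (a marker never produces a `2`). [folklore] -/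
theorem lam_terms : ∀ (T : List (Fin 5)), (∀ a ∈ T, a = 0 ∨ a = 1 ∨ a = 2 ∨ a = 3) →
    ∀ t ∈ expand lam T, (∀ a ∈ t.2, a = 1 ∨ a = 2 ∨ a = 3) ∧ t.2.length = T.length ∧
      t.2.count 2 + T.count 0 ≤ T.length
  | [], _, t, ht => by
    rw [expand_nil, List.mem_singleton] at ht
    subst ht
    simp
  | a :: T, hT, t, ht => by
    have hT' : ∀ b ∈ T, b = 0 ∨ b = 1 ∨ b = 2 ∨ b = 3 := fun b hb => hT b (List.mem_cons_of_mem a hb)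
    rw [expand_cons, List.mem_flatMap] at ht
    obtain ⟨cb, hcb, ht⟩ := ht
    obtain ⟨dV, hdV, rfl⟩ := List.mem_map.1 ht
    obtain ⟨h1, h2, h3⟩ := lam_terms T hT' dV hdV
    -- the letter `cb.2` produced from `a`: a unit letter, and not `2` when `a` is the marker
    have key : (cb.2 = 1 ∨ cb.2 = 2 ∨ cb.2 = 3) ∧ (a = 0 → cb.2 ≠ 2) := by
      rcases hT a (by simp) with rfl | rfl | rfl | rfl <;>
        simp only [lam, Matrix.cons_val_zero, Matrix.cons_val_one, Matrix.cons_val, List.mem_cons,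
          List.not_mem_nil, or_false] at hcb <;>
        rcases hcb with rfl | rfl <;> decide
    refine ⟨fun b hb => ?_, by simp [h2], ?_⟩
    · rcases List.mem_cons.1 hb with rfl | hb
      · exact key.1
      · exact h1 b hb
    · simp only [List.count_cons, List.length_cons, beq_iff_eq]
      by_cases ha : a = 0
      · have : cb.2 ≠ 2 := key.2 ha
        simp [ha, this]; omega
      · simp [ha]; split_ifs <;> omega

/-- The sum of the involution images of a term list: `Σ_{(c, U)} c • sigmaSubst U`. [folklore] -/
def sigmaSum (X : List (ℤ × List (Fin 5))) : List (Fin 5) →₀ ℤ := (X.map fun t => t.1 • sigmaSubst t.2).sum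

/-- For words of a common length `n`, the sum of the involution images is `(−1)^n` times the REVERSED
expansion of `ofTerms X` under `sigmaLetter`. [cite: Zhao2008, §4] -/
theorem sigmaSum_eq (n : ℕ) : ∀ X : List (ℤ × List (Fin 5)), (∀ t ∈ X, t.2.length = n) →
    sigmaSum X = ((-1 : ℤ) ^ n) • (expandZ sigmaLetter (ofTerms X)).mapDomain List.reverse
  | [], _ => by simp [sigmaSum]
  | t :: X, hX => by
    have ht : t.2.length = n := hX t (by simp)
    have ih := sigmaSum_eq n X fun u hu => hX u (List.mem_cons_of_mem t hu)
    rw [sigmaSum, List.map_cons, List.sum_cons, ← sigmaSum, ih, ofTerms_cons, map_add, expandZ_single,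
      Finsupp.mapDomain_add, smul_add, sigmaSubst, ht, ofTerms_map_reverse, Finsupp.mapDomain_smul,
      smul_comm]

/-- The sum `Σ c • invGen U` over a term list of CONVERGENT words lies in `rel`. [folklore] -/
theorem sum_invGen_mem_rel : ∀ X : List (ℤ × List (Fin 5)), (∀ t ∈ X, IsConvergent t.2) →
    (X.map fun t => t.1 • invGen t.2).sum ∈ rel
  | [], _ => by simp
  | t :: X, hX => by
    rw [List.map_cons, List.sum_cons]
    exact rel.add_mem (zsmul_mem (mem_rel_of_isGen (IsGen.inv (hX t (by simp)))) _)
      (sum_invGen_mem_rel X fun u hu => hX u (List.mem_cons_of_mem t hu))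

/-- `Σ c • invGen U = Σ c • [U] − toQ (sigmaSum X)`. [folklore] -/
theorem sum_invGen_eq (X : List (ℤ × List (Fin 5))) :
    (X.map fun t => t.1 • invGen t.2).sum = toQ (ofTerms X) - toQ (sigmaSum X) := by
  induction X with
  | nil => simp [sigmaSum]
  | cons t X ih =>
    have hs : sigmaSum (t :: X) = t.1 • sigmaSubst t.2 + sigmaSum X := by simp [sigmaSum]
    rw [List.map_cons, List.sum_cons, ih, ofTerms_cons, map_add, toQ_single, hs, map_add, map_zsmul,
      invGen, smul_sub]
    abel

end ManyTwos

open Literature.NumberTheory.Transcendental Literature.NumberTheory.Transcendental.LevelFour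

open ManyTwos in
/-- **The σ-inclusion–exclusion (registered helper stub `unit_manyTwos`, block F2, ALL weights).** A unit
word with more letters `2` (pole `−1`) than other letters lies, modulo `rel`, in the span of the unit words of
the same length with fewer letters `2`. Proof: with `W := conj (reverse V)`, `j + 1 := |W| − #2(W) + 1 ≤ #2(W)`
and the template `T := mark (j+1) W`, the combination `X := expand lam T` of involution generators satisfies
`Σ c • invGen U ∈ rel`, `Σ c • [U] ∈ lower` (`lam_terms`), and `Σ c • sigmaSubst U = ±reverse (EQ chi T)
= [V] + lower` (`sigmaSum_eq`, multilinearity `expandZ_ofTerms_expand`, `main_term`). [folklore] -/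
theorem unit_manyTwos (V : List (Fin 5)) (hU : ∀ a ∈ V, a = 1 ∨ a = 2 ∨ a = 3)
    (h : V.length < 2 * V.count 2) :
    sym V ∈ rel ⊔ Submodule.span ℚ (sym '' {V' | V'.length = V.length ∧
      (∀ a ∈ V', a = 1 ∨ a = 2 ∨ a = 3) ∧ V'.count 2 < V.count 2}) := by
  -- the word `W = conj (reverse V)` and its template
  set W : List (Fin 5) := conjWord V.reverse with hWdef
  have hWU : ∀ a ∈ W, a = 1 ∨ a = 2 ∨ a = 3 :=
    (conjWord_unit (W := V.reverse) fun a ha => hU a (List.mem_reverse.1 ha)).1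
  have hW2 : W.count 2 = V.count 2 := by
    rw [hWdef, (conjWord_unit (W := V.reverse) fun a ha => hU a (List.mem_reverse.1 ha)).2,
      List.count_reverse]
  have hWlen : W.length = V.length := by rw [hWdef, length_conjWord, List.length_reverse]
  have hW0 : (0 : Fin 5) ∉ W := fun h0 => by rcases hWU 0 h0 with h | h | h <;> exact absurd h (by decide)
  set n := V.length with hn
  set m := W.length - W.count 2 + 1 with hm
  have hmle : m ≤ W.count 2 := by omega
  set T := mark m W with hTdef
  have hT0 : T.count 0 = m := count_zero_mark m W hW0 hmle
  have hTlen : T.length = n := by rw [hTdef, length_mark, hWlen]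
  have hTW : unmark T = W := unmark_mark m W hW0
  have hTlet : ∀ a ∈ T, a = 0 ∨ a = 1 ∨ a = 2 ∨ a = 3 := fun a ha =>
    (mem_mark m W a ha).elim Or.inl fun h' => Or.inr (hWU a h')
  -- the combination of involution generators
  set X := expand lam T with hXdef
  have hXt := lam_terms T hTlet
  have hXunit : ∀ t ∈ X, ∀ a ∈ t.2, a = 1 ∨ a = 2 ∨ a = 3 := fun t ht => (hXt t ht).1
  have hXlen : ∀ t ∈ X, t.2.length = n := fun t ht => (hXt t ht).2.1.trans hTlen
  have hXlow : toQ (ofTerms X) ∈ LowQ n (V.count 2) := by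
    refine RegularE0.toQ_ofTerms_mem _ X fun t ht => sym_mem_LowQ (hXlen t ht) (hXunit t ht) ?_
    have := (hXt t ht).2.2
    rw [hT0, hTlen] at this
    omega
  have hrel : (X.map fun t => t.1 • invGen t.2).sum ∈ rel :=
    sum_invGen_mem_rel X fun t ht => RegularUnit.isConvergent_of_isUnitWord (hXunit t ht)
  -- the sum of the involution images is `[V] + lower`
  obtain ⟨l, hl, hEQ⟩ : ∃ l ∈ LowQ n (V.count 2), EQ chi T = l + ((-1 : ℤ) ^ n) • sym (conjWord W) := by
    refine ⟨EQ chi T - ((-1 : ℤ) ^ T.length) • sym (conjWord (unmark T)), ?_, ?_⟩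
    · have hmain := main_term T hTlet
      rw [hTlen, hTW, hW2] at hmain
      rw [hTlen, hTW]
      exact hmain
    · rw [hTlen, hTW]; abel
  have hrevW : (conjWord W).reverse = V := by
    rw [hWdef, conjWord_conjWord, List.reverse_reverse]
  have hsig : toQ (sigmaSum X) = sym V + ((-1 : ℤ) ^ n) • Finsupp.lmapDomain ℚ ℚ List.reverse l := by
    rw [sigmaSum_eq n X hXlen, map_zsmul, toQ_mapDomain, hXdef, expandZ_ofTerms_expand, ← chi, ← EQ,
      hEQ, map_add, smul_add, map_zsmul, smul_smul, ← pow_add, Even.neg_one_pow ⟨n, rfl⟩, one_smul]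
    simp only [Finsupp.lmapDomain_apply, sym, Finsupp.mapDomain_single, hrevW]
    rw [add_comm]
  -- conclusion
  have key : sym V = (toQ (ofTerms X) - (X.map fun t => t.1 • invGen t.2).sum) -
      ((-1 : ℤ) ^ n) • Finsupp.lmapDomain ℚ ℚ List.reverse l := by
    rw [sum_invGen_eq, hsig]; abel
  rw [key]
  refine Submodule.sub_mem _ (Submodule.sub_mem _ (Submodule.mem_sup_right hXlow)
    (Submodule.mem_sup_left hrel)) (Submodule.mem_sup_right (zsmul_mem (reverse_mem_LowQ hl) _))

end Summit.KontsevichZagierPeriods.OctahedralSymmetry.OctaSpan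

end
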